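import Literature.Probability.LatticeModels.PlaneRotatorLROProofs
import Literature.Probability.LatticeModels.RotatorAngleCubeGinibre
import HarnessLib

/-!
# Long-range order of the LAYERED (direction-dependent) plane rotator on `(ℤ/Lℤ)³` above the interlayer threshold: a certified ordering floor from the interlayer coupling alone

Topic `Probability/LatticeModels`; companion of `PlaneRotatorLRO.lean` / `PlaneRotatorLROProofs.lean`
(Fröhlich–Simon–Spencer 1976 via Friedli–Velenik 2017 Thm. 10.25: orientational long-range order of the
ISOTROPIC classical XY model on `(ℤ/Lℤ)³` for `J > J₀ = latticeGreen 0`) and of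
`PlaneRotatorGinibreComparison.lean` (Ginibre 1970: two-point functions are non-decreasing in the
ferromagnetic couplings; "the layered model dominates the single layer"). The object is the classical
plane rotator on the three-dimensional torus with DIRECTION-DEPENDENT nearest-neighbour couplings
`K = (K₀, K₁, K₂)` (angles `θ_x`, weight `exp{∑_{(x,i)} K_i cos(θ_{x+eᵢ} − θ_x)}` on `[0,2π]^{𝕋_L}`); the
LAYERED model of the `hubbard-tc` cell's interlayer grammar (`LayeredPlaneRotatorDecoupling.lean`,
`PlaneRotatorLiebCriterion.lean`: in-plane `J∥`, interlayer `J⊥`, inverse temperature absorbed) is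
`K = (J∥, J∥, J⊥)` (`layeredCoupling`).

PROVED here (no named fact):

* `AnisotropicRotator.corr_eq_ginibreExpect` — the angle-cube two-point function
  `⟨cos(θ_x − θ_y)⟩_K` is the Ginibre expectation on `U(1)^{𝕋_L}` for the bond characters
  `θ̄_x θ_{x+eᵢ}` with couplings `K_i` (the tree's `rotator_twoPoint_div_eq_ginibreExpect`, now with a
  coupling per bond);
* `AnisotropicRotator.corr_mono`, `plateau_mono` — **Ginibre monotonicity in the direction-dependent
  couplings**: `0 ≤ K ≤ K'` componentwise ⇒ `⟨cos(θ_x − θ_y)⟩_K ≤ ⟨cos(θ_x − θ_y)⟩_{K'}` and the same for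
  the torus plateau `L⁻⁶∑_{x,y}⟨cos(θ_x − θ_y)⟩` [Ginibre 1970, Prop. 3 with Example 4];
* `AnisotropicRotator.isotropic_plateau_ge` — the isotropic FINITE-VOLUME floor behind
  `FriedliVelenik2017_thm1025_planeRotator3_holds`, exposed with its explicit constant: for every
  `J > 0` and every even `L ≥ 4`, `L⁻⁶∑_{x,y}⟨cos(θ_x − θ_y)⟩_{(J,J,J)} ≥ 1 − torusGreen 0 / J`,
  `torusGreen 0 = L⁻³∑_{k≠0} ε(2πk/L)⁻¹`, `ε(p) = ∑ᵢ(1 − cos pᵢ)` [FV2017 Thm 10.24/10.25, (10.40)];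
* `AnisotropicRotator.plateau_ge_of_le` — **the floor from the weakest direction**: if
  `0 < J ≤ K_i` for all `i`, then for every even `L ≥ 4`,
  `L⁻⁶∑_{x,y}⟨cos(θ_x − θ_y)⟩_K ≥ 1 − torusGreen 0 / J`; `layered_plateau_ge`: for
  `0 < J⊥ ≤ J∥`, `L⁻⁶∑_{x,y}⟨cos(θ_x − θ_y)⟩_{(J∥,J∥,J⊥)} ≥ 1 − torusGreen 0 / J⊥`;
* `AnisotropicRotator.layered_longRangeOrder` — the thermodynamic-limit form: for `0 < J⊥ ≤ J∥` and
  `ε > 0`, for all large even `L`, the layered plateau is `≥ 1 − latticeGreen 0 / J⊥ − ε`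
  (`latticeGreen 0 = ∫_{[-π,π]³} ε(p)⁻¹ dp/(2π)³ = J₀`, the printed isotropic threshold; numerically
  `J₀ ≈ 0.5055` [float, Watson's integral; not certified here]). In words: the layered classical XY
  model has orientational long-range order as soon as the INTERLAYER coupling alone exceeds the
  isotropic three-dimensional threshold, `J⊥ > J₀`, uniformly in `J∥ ≥ J⊥` — in temperature units
  (`J = J_phys/T`) an ordering FLOOR `T < J⊥,phys / J₀`.

What this is and is not. It is the composition of two tree theorems (Ginibre comparison with the
isotropic model at coupling `min_i K_i`, and the Fröhlich–Simon–Spencer infrared-bound floor for that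
isotropic model), hence a floor that ignores the in-plane excess `J∥ − J⊥`: it is LINEAR in `J⊥`. The
reflection-positivity infrared bound applies DIRECTLY to direction-dependent nearest-neighbour couplings
(Fröhlich–Israel–Lieb–Simon 1978, §3 (C) eq. (3.6): reflection positivity through planes perpendicular
to axis `j` only involves `K_j ≥ 0`; Thms. 4.6–4.7 and (4.6)–(4.10): Gaussian domination
`Z(h) ≤ Z(0)` and `g(p) ≤ (2βE_p)⁻¹` with the anisotropic dispersion
`E_p = ∑ᵢ K_i(1 − cos pᵢ)`, as in Kennedy–Lieb–Shastry 1988 eq. (7) `E^r_q = 2 − cos q₁ − cos q₂ +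
r(1 − cos q₃)` for the quantum antiferromagnet interpolating between two and three dimensions) and
gives the sharper floor `1 − L⁻³∑_{k≠0} (2·∑ᵢK_i(1 − cos k_i))⁻¹·(ν/2)` whose threshold in `J∥` grows
only logarithmically in `J∥/J⊥`; that anisotropic Gaussian-domination step is NOT in the tree (its
`ν`-vector engine `NVectorInfraredBoundProofs.lean` is isotropic) —
`-- TODO(general form): anisotropic Gaussian domination / infrared bound with E_p = ∑ᵢ K_i(1 − cos pᵢ)`.
No transition temperature is defined for rotators in the tree; nothing here is a statement about a
quantum or fermionic model.

## References

* J. Ginibre, *General formulation of Griffiths' inequalities*, Comm. Math. Phys. 16 (1970) 310–328,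
  Prop. 3 with Example 4 (plane rotators) [Ginibre1970].
* S. Friedli, Y. Velenik, *Statistical Mechanics of Lattice Systems*, CUP (2017), Thm. 10.24,
  Thm. 10.25, (10.40)–(10.42) [FriedliVelenikSMLS2017]; J. Fröhlich, B. Simon, T. Spencer, Comm. Math.
  Phys. 50 (1976) 79–95 [FrohlichSimonSpencer1976].
* J. Fröhlich, R. Israel, E. H. Lieb, B. Simon, *Phase transitions and reflection positivity. I*,
  Comm. Math. Phys. 62 (1978) 1–34, §3 (C) eq. (3.6), Thms. 4.6–4.7, (4.6)–(4.10) (Lieb Selecta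
  *Statistical Mechanics* pp. 222–225, read) [FILS1978].
* T. Kennedy, E. H. Lieb, B. S. Shastry, J. Stat. Phys. 53 (1988) 1019–1030, eqs. (5)–(7) (the layered
  dispersion `E^r_q`) [KLS1988JSP].
-/

noncomputable section

open MeasureTheory Set Finset Filter
open scoped BigOperators Real

namespace Literature.Probability.LatticeModels

namespace AnisotropicRotator

variable {L : ℕ}

/-! ### The model: direction-dependent nearest-neighbour couplings on `(ℤ/Lℤ)³` -/

/-- The **layered coupling vector** `(J∥, J∥, J⊥)`: in-plane coupling `Jpar` in directions `0, 1`,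
interlayer coupling `Jperp` in direction `2` (inverse temperature absorbed). [folklore] -/
def layeredCoupling (Jpar Jperp : ℝ) (i : Fin 3) : ℝ := if i = 2 then Jperp else Jpar

/-- The angle-form Boltzmann weight of the anisotropic nearest-neighbour plane rotator on `(ℤ/Lℤ)³`:
`w_K(θ) = exp{∑_{(x,i)} K_i cos(θ_{x+eᵢ} − θ_x)}` (each directed bond `(x, i)` once; for constant `K`
this is the weight of `FriedliVelenik2017_thm1025_planeRotator3`).
[cite: FriedliVelenikSMLS2017, §10.5.1 Example 10.22 (isotropic case)] -/
def weight [NeZero L] (K : Fin 3 → ℝ) (θ : TorusSite 3 L → ℝ) : ℝ :=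
  Real.exp (∑ b : TorusSite 3 L × Fin 3, K b.2 * Real.cos (θ (b.1 + Pi.single b.2 1) - θ b.1))

/-- The two-point function `⟨cos(θ_x − θ_y)⟩_K` of the anisotropic plane rotator, as a ratio of
angle-cube integrals over `[0,2π]^{𝕋_L}`. [cite: FriedliVelenikSMLS2017, §10.5.2 (isotropic case)] -/
def corr [NeZero L] (K : Fin 3 → ℝ) (x y : TorusSite 3 L) : ℝ :=
  (∫ θ in Set.pi Set.univ (fun _ : TorusSite 3 L => Icc (0 : ℝ) (2 * π)),
      Real.cos (θ x - θ y) * weight K θ) /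
    ∫ θ in Set.pi Set.univ (fun _ : TorusSite 3 L => Icc (0 : ℝ) (2 * π)), weight K θ

variable (L) in
/-- The torus plateau `L⁻⁶ ∑_{x,y} ⟨cos(θ_x − θ_y)⟩_K = ⟨‖m_L‖²⟩_K` (long-range-order parameter of
the anisotropic plane rotator on `(ℤ/Lℤ)³`). [cite: FriedliVelenikSMLS2017, (10.39)–(10.42) (isotropic case)] -/
def plateau [NeZero L] (K : Fin 3 → ℝ) : ℝ :=
  (∑ x : TorusSite 3 L, ∑ y : TorusSite 3 L, corr K x y) / (L : ℝ) ^ 6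

/-- Every component of the layered coupling vector is at least `J⊥` when `J⊥ ≤ J∥`. [folklore] -/
private theorem le_layeredCoupling {Jpar Jperp : ℝ} (h : Jperp ≤ Jpar) (i : Fin 3) :
    Jperp ≤ layeredCoupling Jpar Jperp i := by
  unfold layeredCoupling
  split_ifs
  · exact le_rfl
  · exact h

/-- For a constant coupling vector the weight is the isotropic XY weight
`exp(J ∑_{(x,i)} cos(θ_{x+eᵢ} − θ_x))` of Friedli–Velenik's Example 10.22 (angle form).
[cite: FriedliVelenikSMLS2017, §10.5.1 Example 10.22] -/
theorem weight_const [NeZero L] (J : ℝ) (θ : TorusSite 3 L → ℝ) :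
    weight (fun _ => J) θ =
      Real.exp (J * ∑ b : TorusSite 3 L × Fin 3, Real.cos (θ (b.1 + Pi.single b.2 1) - θ b.1)) := by
  rw [weight, Finset.mul_sum]

/-! ### The anisotropic rotator on the angle cube is a Ginibre model on `U(1)^{𝕋_L}` -/

section Ginibre

variable {V : Type*} [Fintype V]

omit [Fintype V] in
/-- The rotator weight in angles with a coupling PER BOND: for bond characters `χ_k = θ̄_{s k} θ_{t k}`
and couplings `J k`, `ginibreWeight χ J (e^{iθ}) = exp(∑_k J k · cos(θ_{t k} − θ_{s k}))` — Ginibre's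
plane-rotator weight `exp ∑ J_A cos(m_A·φ)` in angles (the tree's `ginibreWeight_diffChar_exp` is the
constant-coupling case). [cite: Ginibre1970, Example 4 (plane rotators, cos(m·φ))] -/
theorem ginibreWeight_diffChar_exp_fun {κ : Type*} [Fintype κ] (s t : κ → V) (J : κ → ℝ)
    (θ : V → ℝ) :
    ginibreWeight (fun k => diffChar (s k) (t k)) J (fun v => Circle.exp (θ v)) =
      Real.exp (∑ k, J k * Real.cos (θ (t k) - θ (s k))) := by
  rw [ginibreWeight, ginibreHamiltonian]
  congr 1
  refine Finset.sum_congr rfl fun k _ => ?_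
  rw [reChar_diffChar_exp]

/-- **The rotator with a coupling per bond on the angle cube is the Ginibre model on `U(1)^V`**:
`∫_{[0,2π]^V} cos(θ_x − θ_y) e^{∑_k J_k cos(θ_{t k} − θ_{s k})} dθ / ∫_{[0,2π]^V} e^{∑_k J_k cos(θ_{t k} − θ_{s k})} dθ
= ⟨Re χ_{y,x}⟩_J` on the torus `U(1)^V` (Haar probability measure), bond characters
`χ_k = θ̄_{s k} θ_{t k}`, couplings `J_k`. [cite: Ginibre1970, main theorem with the plane-rotator example] -/
theorem twoPoint_div_eq_ginibreExpect_fun {κ : Type*} [Fintype κ] (s t : κ → V) (J : κ → ℝ)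
    (x y : V) :
    (∫ θ in Set.pi univ (fun _ : V => Icc (0 : ℝ) (2 * Real.pi)),
        Real.cos (θ x - θ y) * Real.exp (∑ k, J k * Real.cos (θ (t k) - θ (s k)))) /
      (∫ θ in Set.pi univ (fun _ : V => Icc (0 : ℝ) (2 * Real.pi)),
        Real.exp (∑ k, J k * Real.cos (θ (t k) - θ (s k)))) =
    ginibreExpect (torusHaar V) (fun k => diffChar (s k) (t k)) J (reChar (diffChar y x)) := by
  set χ : κ → (V → Circle) →ₜ* Circle := fun k => diffChar (s k) (t k) with hχ
  have hwc : Continuous (ginibreWeight χ J) := continuous_ginibreWeight χ _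
  have hfc : Continuous fun u => reChar (diffChar y x) u * ginibreWeight χ J u :=
    (continuous_reChar _).mul hwc
  have h1 := setIntegral_angleCube_comp_exp (V := V) _ hfc.aestronglyMeasurable
  have h2 := setIntegral_angleCube_comp_exp (V := V) _ hwc.aestronglyMeasurable
  simp only [hχ, reChar_diffChar_exp, ginibreWeight_diffChar_exp_fun, smul_eq_mul] at h1 h2
  rw [h1, h2, ginibreExpect, mul_div_mul_left _ _ (by positivity)]

end Ginibre

/-- **The anisotropic two-point function as a Ginibre expectation**: `⟨cos(θ_x − θ_y)⟩_K` is the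
Gibbs expectation of `Re(θ̄_y θ_x)` on `U(1)^{𝕋_L}` for the bond characters `θ̄_x θ_{x+eᵢ}` indexed by
the directed bonds `(x, i)` with couplings `K_i`. [cite: Ginibre1970, Example 4 (plane rotators)] -/
theorem corr_eq_ginibreExpect [NeZero L] (K : Fin 3 → ℝ) (x y : TorusSite 3 L) :
    corr K x y =
      ginibreExpect (torusHaar (TorusSite 3 L))
        (fun b : TorusSite 3 L × Fin 3 => diffChar b.1 (b.1 + Pi.single b.2 1))
        (fun b => K b.2) (reChar (diffChar y x)) := by
  rw [corr]
  simp only [weight]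
  exact twoPoint_div_eq_ginibreExpect_fun (fun b : TorusSite 3 L × Fin 3 => b.1)
    (fun b => b.1 + Pi.single b.2 1) (fun b => K b.2) x y

/-! ### Ginibre monotonicity in the direction-dependent couplings -/

/-- **Monotonicity** (Ginibre): `0 ≤ K_i ≤ K'_i` for all directions `i` ⇒
`⟨cos(θ_x − θ_y)⟩_K ≤ ⟨cos(θ_x − θ_y)⟩_{K'}` on every torus `(ℤ/Lℤ)³`. In particular raising the
in-plane couplings of a layered model above its interlayer coupling can only increase correlations.
[cite: Ginibre1970, Prop. 3 with Example 4 (plane rotators)] -/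
theorem corr_mono [NeZero L] {K K' : Fin 3 → ℝ} (hK : ∀ i, 0 ≤ K i) (hKK' : ∀ i, K i ≤ K' i)
    (x y : TorusSite 3 L) : corr K x y ≤ corr K' x y := by
  rw [corr_eq_ginibreExpect, corr_eq_ginibreExpect]
  exact ginibreExpect_reChar_mono _ surjective_mul_self_torus _ _ (fun b => hK b.2)
    (fun b => hKK' b.2)

variable (L) in
/-- **Monotonicity of the plateau**: `0 ≤ K ≤ K'` componentwise ⇒ `plateau L K ≤ plateau L K'`.
[cite: Ginibre1970, Prop. 3 with Example 4 (plane rotators)] -/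
theorem plateau_mono [NeZero L] {K K' : Fin 3 → ℝ} (hK : ∀ i, 0 ≤ K i) (hKK' : ∀ i, K i ≤ K' i) :
    plateau L K ≤ plateau L K' := by
  unfold plateau
  exact div_le_div_of_nonneg_right
    (Finset.sum_le_sum fun x _ => Finset.sum_le_sum fun y _ => corr_mono hK hKK' x y)
    (by positivity)

/-! ### The isotropic finite-volume floor with its explicit constant -/

variable (L) in
/-- The plateau of the constant coupling vector is the plateau of the isotropic plane rotator in the
form of `FriedliVelenik2017_thm1025_planeRotator3` (one Boltzmann weight `e^{J∑cos}`, sums pulled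
through the integral; Friedli–Velenik's `⟨‖m_L‖²⟩` of (10.39) in angles).
[cite: FriedliVelenikSMLS2017, (10.39) with Example 10.22] -/
theorem plateau_const_eq [NeZero L] (J : ℝ) :
    plateau L (fun _ => J) =
      (∑ x : TorusSite 3 L, ∑ y : TorusSite 3 L,
          ∫ θ in Set.pi Set.univ (fun _ : TorusSite 3 L => Icc (0 : ℝ) (2 * π)),
            Real.cos (θ x - θ y) *
              Real.exp (J * ∑ b : TorusSite 3 L × Fin 3,
                Real.cos (θ (b.1 + Pi.single b.2 1) - θ b.1))) /
        ((∫ θ in Set.pi Set.univ (fun _ : TorusSite 3 L => Icc (0 : ℝ) (2 * π)),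
            Real.exp (J * ∑ b : TorusSite 3 L × Fin 3,
              Real.cos (θ (b.1 + Pi.single b.2 1) - θ b.1))) * (L : ℝ) ^ 6) := by
  unfold plateau corr
  simp only [weight_const]
  rw [← div_div]
  congr 1
  rw [Finset.sum_div]
  refine Finset.sum_congr rfl fun x _ => ?_
  rw [Finset.sum_div]

variable (L) in
/-- **The isotropic finite-volume long-range-order floor, explicit constant** (the inequality inside
`FriedliVelenik2017_thm1025_planeRotator3_holds`, before the Riemann-sum limit): for the isotropic plane
rotator at coupling `J > 0` on `(ℤ/Lℤ)³`, `L` even, `L ≥ 4`,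
`L⁻⁶∑_{x,y}⟨cos(θ_x − θ_y)⟩_J ≥ 1 − torusGreen 0 / J` with
`torusGreen 0 = L⁻³∑_{k≠0} ε(2πk/L)⁻¹` (Friedli–Velenik's display after Thm. 10.24 with `ν = 2`,
`β = J/2`, for the uniform law on the circle, Example 10.22). [cite: FriedliVelenikSMLS2017, Thm 10.24 and the display following it, (10.40), Example 10.22] -/
theorem isotropic_plateau_ge [NeZero L] (hLe : Even L) (hL4 : 4 ≤ L) {J : ℝ} (hJ : 0 < J) :
    1 - torusGreen (0 : TorusSite 3 L) / J ≤ plateau L (fun _ => J) := by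
  have hfact := (FriedliVelenik2017_nVector_infraredBound_holds 3 L 2 hLe hL4
    (Measure.map (fun t : ℝ => (![Real.cos t, Real.sin t] : Fin 2 → ℝ))
      (volume.restrict (Set.Icc (0 : ℝ) (2 * π))))
    (PlaneRotator.exists_isCompact_map_angleLaw PlaneRotator.continuous_cosSin)
    (PlaneRotator.map_angleLaw_ne_zero PlaneRotator.continuous_cosSin.measurable) (J / 2)
    (by positivity)).2
    (PlaneRotator.ae_map_angleLaw PlaneRotator.continuous_cosSin PlaneRotator.sum_cosSin_sq)
  rw [PlaneRotator.inv_mul_sum_inv_dispersion_eq_torusGreen,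
    PlaneRotator.integral_magnetisationNormSq_nVectorGibbs_cosSin hJ] at hfact
  have hcoef : ((2 : ℕ) : ℝ) / (4 * (J / 2)) * torusGreen (0 : TorusSite 3 L) =
      torusGreen (0 : TorusSite 3 L) / J := by
    push_cast
    field_simp
    ring
  rw [hcoef] at hfact
  rw [plateau_const_eq]
  exact hfact

/-! ### The floor from the weakest direction; the layered model -/

variable (L) in
/-- **Long-range order of the anisotropic plane rotator from its weakest coupling** (finite volume,
explicit): if `0 < J ≤ K_i` for all three directions, then on every even torus `(ℤ/Lℤ)³`, `L ≥ 4`,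
`L⁻⁶∑_{x,y}⟨cos(θ_x − θ_y)⟩_K ≥ 1 − torusGreen 0 / J` — Ginibre comparison with the isotropic model at
coupling `J` (`plateau_mono`) and the isotropic infrared-bound floor (`isotropic_plateau_ge`).
[cite: Ginibre1970, Prop. 3 with Example 4] [cite: FriedliVelenikSMLS2017, Thm 10.24/10.25, (10.40)] -/
theorem plateau_ge_of_le [NeZero L] (hLe : Even L) (hL4 : 4 ≤ L) {K : Fin 3 → ℝ} {J : ℝ}
    (hJ : 0 < J) (hK : ∀ i, J ≤ K i) :
    1 - torusGreen (0 : TorusSite 3 L) / J ≤ plateau L K :=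
  (isotropic_plateau_ge L hLe hL4 hJ).trans
    (plateau_mono L (fun _ => hJ.le) hK)

variable (L) in
/-- **The layered model, finite volume**: for in-plane coupling `J∥` and interlayer coupling `J⊥` with
`0 < J⊥ ≤ J∥`, on every even torus `(ℤ/Lℤ)³`, `L ≥ 4`, the classical layered XY model
`exp{J∥∑_{in-plane bonds}cos(θ_x − θ_y) + J⊥∑_{vertical bonds}cos(θ_x − θ_y)}` has
`L⁻⁶∑_{x,y}⟨cos(θ_x − θ_y)⟩ ≥ 1 − torusGreen 0 / J⊥`. [cite: Ginibre1970, Prop. 3 with Example 4] [cite: FriedliVelenikSMLS2017, Thm 10.24/10.25, (10.40)] -/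
theorem layered_plateau_ge [NeZero L] (hLe : Even L) (hL4 : 4 ≤ L) {Jpar Jperp : ℝ}
    (hperp : 0 < Jperp) (hle : Jperp ≤ Jpar) :
    1 - torusGreen (0 : TorusSite 3 L) / Jperp ≤ plateau L (layeredCoupling Jpar Jperp) :=
  plateau_ge_of_le L hLe hL4 hperp (le_layeredCoupling hle)

/-- **Long-range order of the layered classical XY model above the interlayer threshold**
(thermodynamic-limit form): for `0 < J⊥ ≤ J∥` and every `ε > 0` there is `L₀` such that for all even
`L ≥ 4` with `L ≥ L₀` the layered plateau satisfies
`L⁻⁶∑_{x,y}⟨cos(θ_x − θ_y)⟩_{(J∥,J∥,J⊥)} ≥ 1 − latticeGreen 0 / J⊥ − ε`,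
`latticeGreen 0 = ∫_{[-π,π]³} (∑ᵢ(1 − cos pᵢ))⁻¹ dp/(2π)³ = J₀` — the isotropic threshold of
Fröhlich–Simon–Spencer / Friedli–Velenik Thm. 10.25 (`J₀ = 2β₀`). Hence ORIENTATIONAL LONG-RANGE ORDER
(plateau bounded below by `1 − J₀/J⊥ − ε > 0` for all large even `L`) as soon as the interlayer
coupling alone exceeds the isotropic threshold, `J⊥ > J₀`, uniformly in the in-plane coupling
`J∥ ≥ J⊥`; in temperature units an ordering floor `T < J⊥,phys/J₀`. (The reflection-positivity infrared
bound for direction-dependent couplings, FILS 1978 §3 (C)/(4.6)–(4.10) with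
`E_p = ∑ᵢ K_i(1 − cos pᵢ)`, would replace `J₀/J⊥` by the anisotropic Green function — TODO(general
form), see the module docstring.)
[cite: Ginibre1970, Prop. 3 with Example 4] [cite: FriedliVelenikSMLS2017, Thm 10.25 with (10.41)–(10.42)] -/
theorem layered_longRangeOrder {Jpar Jperp : ℝ} (hperp : 0 < Jperp) (hle : Jperp ≤ Jpar) {ε : ℝ}
    (hε : 0 < ε) :
    ∃ L₀ : ℕ, ∀ (L : ℕ) [NeZero L], L₀ ≤ L → Even L → 4 ≤ L →
      1 - latticeGreen (0 : Site 3) / Jperp - ε ≤ plateau L (layeredCoupling Jpar Jperp) := by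
  obtain ⟨L₀, hL₀⟩ :=
    torusGreen_tendsto_latticeGreen (d := 3) le_rfl (0 : Site 3) (ε := ε * Jperp) (by positivity)
  refine ⟨L₀, fun L _ hL0 hLe hL4 => ?_⟩
  have hG : torusGreen (0 : TorusSite 3 L) ≤ latticeGreen (0 : Site 3) + ε * Jperp := by
    have h := hL₀ L hLe hL0
    rw [PlaneRotator.torusProj_zero] at h
    linarith [(abs_le.1 h).2]
  have hdiv : torusGreen (0 : TorusSite 3 L) / Jperp ≤ latticeGreen (0 : Site 3) / Jperp + ε := by
    rw [div_le_iff₀ hperp, add_mul, div_mul_cancel₀ _ hperp.ne']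
    exact hG
  have h := layered_plateau_ge L hLe hL4 hperp hle
  linarith

/-- **The same for a general direction-dependent coupling vector** bounded below by `J > 0`:
eventually in even `L`, `plateau L K ≥ 1 − latticeGreen 0 / J − ε`; long-range order whenever the
weakest coupling exceeds `J₀ = latticeGreen 0`.
[cite: Ginibre1970, Prop. 3 with Example 4] [cite: FriedliVelenikSMLS2017, Thm 10.25 with (10.41)–(10.42)] -/
theorem longRangeOrder_of_le {K : Fin 3 → ℝ} {J : ℝ} (hJ : 0 < J) (hK : ∀ i, J ≤ K i) {ε : ℝ}
    (hε : 0 < ε) :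
    ∃ L₀ : ℕ, ∀ (L : ℕ) [NeZero L], L₀ ≤ L → Even L → 4 ≤ L →
      1 - latticeGreen (0 : Site 3) / J - ε ≤ plateau L K := by
  obtain ⟨L₀, hL₀⟩ :=
    torusGreen_tendsto_latticeGreen (d := 3) le_rfl (0 : Site 3) (ε := ε * J) (by positivity)
  refine ⟨L₀, fun L _ hL0 hLe hL4 => ?_⟩
  have hG : torusGreen (0 : TorusSite 3 L) ≤ latticeGreen (0 : Site 3) + ε * J := by
    have h := hL₀ L hLe hL0
    rw [PlaneRotator.torusProj_zero] at h
    linarith [(abs_le.1 h).2]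
  have hdiv : torusGreen (0 : TorusSite 3 L) / J ≤ latticeGreen (0 : Site 3) / J + ε := by
    rw [div_le_iff₀ hJ, add_mul, div_mul_cancel₀ _ hJ.ne']
    exact hG
  have h := plateau_ge_of_le L hLe hL4 hJ hK
  linarith

end AnisotropicRotator

end Literature.Probability.LatticeModels
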